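import Literature.NumberTheory.GaloisRepresentations.AbsIntegersLocalization
import Mathlib.RingTheory.Valuation.Integral
import HarnessLib

/-!
# Non-trivial valuation rings of `K̄` ↔ maximal ideals of `ℤ̄` (places of `\bar ℚ` = primes of `\bar ℤ`)

Topic `Literature/NumberTheory/GaloisRepresentations` (continues `AbsIntegersLocalization`).  Let `K` be a number
field, `K̄ = AlgebraicClosure K`, `ℤ̄ = absIntegers (𝓞 K) K` the ring of all algebraic integers of `K̄`.
`AbsIntegersLocalization` attaches to every maximal ideal `𝔓` of `ℤ̄` the valuation ring
`ℤ̄_𝔓 = absIntegersValuationSubring 𝔓` of `K̄`.  THIS FILE proves that this is a BIJECTION onto the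
non-trivial valuation rings of `K̄` — the classical dictionary «finite places of `\bar ℚ` = maximal ideals of
`\bar ℤ`» (Neukirch, *Algebraic Number Theory*, Ch. II §8 (valuations of an algebraic extension are the
localisations of the integral closure at its maximal ideals); Zariski–Samuel, *Commutative Algebra* II, Ch. VI
§4–§5) — and that it is `G_K`-equivariant, so that the two notions of «decomposition group of a finite place of
`K̄`» used in the tree (stabiliser of a valuation ring, `ValuationSubring.decompositionSubgroup` /
`NumberFieldValuationProSet`; stabiliser of a prime of `ℤ̄`, `Ideal`/`absIntegers` side of the Frobenius and
decomposition-group files) AGREE: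

* `mem_valuationSubring_of_isIntegral_int`, `coe_absIntegers_mem_valuationSubring` — `ℤ̄ ⊆ A` for every
  valuation ring `A` of `K̄` (valuation rings are integrally closed);
* `absIntegersCentre A` — the CENTRE of `A` on `ℤ̄`: the prime ideal `𝔪_A ∩ ℤ̄` (`mem_absIntegersCentre_iff`:
  the elements of `ℤ̄` that are non-units of `A`); `absIntegersCentre_top` (`= ⊥` for `A = K̄`),
  `absIntegersCentre_ne_bot` / `absIntegersCentre_isMaximal` (maximal and non-zero for `A ≠ K̄`: every
  `x ∈ K̄` is `w / y` with `w ∈ ℤ̄`, `y ∈ 𝓞 K ∖ 0`; non-zero primes of `ℤ̄` are maximal, `ℤ̄` being integral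
  over the Dedekind domain `𝓞 K`);
* `absIntegersCentre_absIntegersValuationSubring` — the centre of `ℤ̄_𝔓` is `𝔓`;
  `eq_absIntegersValuationSubring_of_absIntegersCentre_eq` — **a valuation ring with centre `𝔓` IS `ℤ̄_𝔓`**
  (elementary: `x ∈ A ∖ ℤ̄_𝔓 ⇒ x⁻¹ = n/d` with `n ∈ 𝔓 ⊆ 𝔪_A`, `d ∉ 𝔓`, so `d = n·x⁻¹… ∈ 𝔪_A ∩ Aˣ`);
  `absIntegersValuationSubring_ne_top`, `absIntegersValuationSubring_injective`;
* `maximalSpectrumEquivValuationSubring` — **`MaximalSpectrum ℤ̄ ≃ {A : ValuationSubring K̄ // A ≠ ⊤}`**;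
* `absIntegersCentre_smul`, `smul_absIntegersValuationSubring`,
  `stabilizer_absIntegersValuationSubring` — `G_K`-equivariance: `σ • ℤ̄_𝔓 = ℤ̄_{σ • 𝔓}` and
  **`Stab_{G_K}(ℤ̄_𝔓) = Stab_{G_K}(𝔓)`**, `stabilizer_eq_stabilizer_absIntegersCentre` (`Stab(A) = Stab(centre A)`).

Everything is proved; the `def`s (`absIntegersToValuationSubring`, `absIntegersCentre`,
`maximalSpectrumEquivValuationSubring`) are genuine.  abc-iut cell use: the bridge asked for by
abc-iut-L4-d2 («CANONICAL-N1»: [AbsTopIII] Rmk 5.1.1 at the number-field model of `V(F̄/F)`), seat abc-iut-w5-d201;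
classical algebraic number theory, nothing here bears on [IUTchIII] Cor. 3.12.

## References
* J. Neukirch, *Algebraic Number Theory* (1999), Ch. II §8 (extensions of valuations; Ex. 8.x: valuation rings of
  an algebraic extension as localisations of the integral closure). [NeukirchANT1999]
* M. F. Atiyah, I. G. Macdonald, *Introduction to Commutative Algebra* (1969), Ch. 5 (valuation rings are
  integrally closed, Prop. 5.18; integral extensions: primes over maximal ideals are maximal, Cor. 5.8). [AtiyahMacdonald1969]
-/

noncomputable section

open scoped NumberField Pointwise

namespace Literature.NumberTheory.GaloisRepresentations

open Field

-- as in `AbsIntegersLocalization`: the pointwise `G_K`-actions on `ℤ̄` and on its ideals are found slowly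
set_option synthInstance.maxHeartbeats 160000

variable {K : Type*} [Field K]

/-! ### `ℤ̄ ⊆ A` for every valuation ring `A` of `K̄` -/

section Integral

variable (A : ValuationSubring (AlgebraicClosure K))

/-- An element of `K̄` integral over `ℤ` lies in every valuation ring of `K̄` (valuation rings are integrally
closed: `Valuation.Integers.mem_of_integral`). [cite: AtiyahMacdonald1969, Prop 5.18] -/
theorem mem_valuationSubring_of_isIntegral_int {x : AlgebraicClosure K} (hx : IsIntegral ℤ x) : x ∈ A := by
  have hx' : IsIntegral A.valuation.integer x := hx.tower_top
  have h := (Valuation.integer.integers A.valuation).mem_of_integral hx'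
  rw [ValuationSubring.integer_valuation] at h
  exact h

/-- `ℤ̄ ⊆ A`: every algebraic integer of `K̄` lies in every valuation ring `A` of `K̄`.
[cite: AtiyahMacdonald1969, Prop 5.18] -/
theorem coe_absIntegers_mem_valuationSubring (a : absIntegers (𝓞 K) K) : (a : AlgebraicClosure K) ∈ A :=
  mem_valuationSubring_of_isIntegral_int A (isIntegral_trans (R := ℤ) (a : AlgebraicClosure K) a.2)

/-- The inclusion `ℤ̄ →+* A` of the algebraic integers into a valuation ring of `K̄`.
[cite: AtiyahMacdonald1969, Prop 5.18] -/
def absIntegersToValuationSubring : absIntegers (𝓞 K) K →+* A where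
  toFun a := ⟨a, coe_absIntegers_mem_valuationSubring A a⟩
  map_one' := Subtype.ext (by simp)
  map_mul' a b := Subtype.ext (by simp)
  map_zero' := Subtype.ext (by simp)
  map_add' a b := Subtype.ext (by simp)

/-- `absIntegersToValuationSubring` is the identity on underlying elements of `K̄`.
[cite: AtiyahMacdonald1969, Prop 5.18] -/
@[simp] theorem coe_absIntegersToValuationSubring (a : absIntegers (𝓞 K) K) :
    ((absIntegersToValuationSubring A a : A) : AlgebraicClosure K) = a := rfl

end Integral

/-! ### The centre of a valuation ring on `ℤ̄` -/

section Centre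

variable (A : ValuationSubring (AlgebraicClosure K))

/-- **The centre `𝔪_A ∩ ℤ̄` of a valuation ring `A` of `K̄` on the algebraic integers**: the prime ideal of
`ℤ̄ = absIntegers (𝓞 K) K` of elements that are NON-units of `A` (the pull-back of the maximal ideal of `A`
along `ℤ̄ → A`). [cite: NeukirchANT1999, Ch. II §8] -/
def absIntegersCentre : Ideal (absIntegers (𝓞 K) K) :=
  (IsLocalRing.maximalIdeal A).comap (absIntegersToValuationSubring A)

/-- `a ∈ 𝔪_A ∩ ℤ̄ ↔ a` is a non-unit of `A` (`A.nonunits`, i.e. `A.valuation a < 1`).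
[cite: NeukirchANT1999, Ch. II §8] -/
theorem mem_absIntegersCentre_iff (a : absIntegers (𝓞 K) K) :
    a ∈ absIntegersCentre A ↔ (a : AlgebraicClosure K) ∈ A.nonunits := by
  rw [absIntegersCentre, Ideal.mem_comap, ← ValuationSubring.coe_mem_nonunits_iff]
  rfl

/-- `a ∈ 𝔪_A ∩ ℤ̄ ↔ a = 0 ∨ a⁻¹ ∉ A`. [cite: NeukirchANT1999, Ch. II §8] -/
theorem mem_absIntegersCentre_iff' (a : absIntegers (𝓞 K) K) :
    a ∈ absIntegersCentre A ↔ (a : AlgebraicClosure K) = 0 ∨ (a : AlgebraicClosure K)⁻¹ ∉ A := by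
  rw [mem_absIntegersCentre_iff, ValuationSubring.mem_nonunits_iff_or]

/-- `a ∉ 𝔪_A ∩ ℤ̄ ↔ a ≠ 0 ∧ a⁻¹ ∈ A` (`a` is a unit of `A`). [cite: NeukirchANT1999, Ch. II §8] -/
theorem not_mem_absIntegersCentre_iff (a : absIntegers (𝓞 K) K) :
    a ∉ absIntegersCentre A ↔ (a : AlgebraicClosure K) ≠ 0 ∧ (a : AlgebraicClosure K)⁻¹ ∈ A := by
  rw [mem_absIntegersCentre_iff', not_or, not_not]

/-- The centre is a prime ideal of `ℤ̄`. [cite: NeukirchANT1999, Ch. II §8] -/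
theorem absIntegersCentre_isPrime : (absIntegersCentre A).IsPrime :=
  Ideal.comap_isPrime _ _

/-- The centre of the trivial valuation ring `K̄` is `0`. [cite: NeukirchANT1999, Ch. II §8] -/
theorem absIntegersCentre_top : absIntegersCentre (⊤ : ValuationSubring (AlgebraicClosure K)) = ⊥ := by
  refine (Submodule.eq_bot_iff _).2 fun a ha => ?_
  rcases (mem_absIntegersCentre_iff' ⊤ a).1 ha with h | h
  · exact Subtype.ext h
  · exact absurd (ValuationSubring.mem_top _) h

/-- **Every element of `K̄` is a quotient `w / y` with `w ∈ ℤ̄` and `y ∈ 𝓞 K ∖ 0`** (clearing denominators of an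
algebraic element). [cite: NeukirchANT1999, Ch. II §8] -/
theorem exists_ringOfIntegers_smul_mem_absIntegers [NumberField K] (x : AlgebraicClosure K) :
    ∃ y : 𝓞 K, y ≠ 0 ∧ (algebraMap (𝓞 K) (AlgebraicClosure K) y) * x ∈ absIntegers (𝓞 K) K := by
  have hx : IsAlgebraic (𝓞 K) x :=
    (IsFractionRing.isAlgebraic_iff (𝓞 K) K (AlgebraicClosure K)).2 (Algebra.IsAlgebraic.isAlgebraic x)
  obtain ⟨y, hy, hint⟩ := hx.exists_integral_multiple
  exact ⟨y, hy, by rwa [Algebra.smul_def] at hint⟩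

/-- If the centre of `A` is `0` then `A = K̄`: every `x = w / y` as above lies in `A`, since `y` is then a unit
of `A`. [cite: NeukirchANT1999, Ch. II §8] -/
theorem eq_top_of_absIntegersCentre_eq_bot [NumberField K] (h : absIntegersCentre A = ⊥) : A = ⊤ := by
  refine le_antisymm (ValuationSubring.le_top _) fun x _ => ?_
  obtain ⟨y, hy, hw⟩ := exists_ringOfIntegers_smul_mem_absIntegers (K := K) x
  set w : absIntegers (𝓞 K) K := ⟨_, hw⟩ with hwdef
  -- `y ∈ 𝓞 K ⊆ ℤ̄` is non-zero, hence (centre `= 0`) a unit of `A`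
  set y' : absIntegers (𝓞 K) K := algebraMap (𝓞 K) (absIntegers (𝓞 K) K) y with hy'def
  have hy'coe : (y' : AlgebraicClosure K) = algebraMap (𝓞 K) (AlgebraicClosure K) y := rfl
  have hy'0 : (y' : AlgebraicClosure K) ≠ 0 := by
    rw [hy'coe, IsScalarTower.algebraMap_apply (𝓞 K) K (AlgebraicClosure K), map_ne_zero,
      map_ne_zero_iff _ (NumberField.RingOfIntegers.coe_injective)]
    exact hy
  have hy'unit : y' ∉ absIntegersCentre A := by
    rw [h, Ideal.mem_bot]
    exact fun h0 => hy'0 (by rw [h0]; rfl)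
  obtain ⟨-, hyinv⟩ := (not_mem_absIntegersCentre_iff A y').1 hy'unit
  have hx : x = (w : AlgebraicClosure K) * (y' : AlgebraicClosure K)⁻¹ := by
    change x = (algebraMap (𝓞 K) (AlgebraicClosure K) y * x) * (algebraMap (𝓞 K) (AlgebraicClosure K) y)⁻¹
    rw [mul_comm (algebraMap _ _ y) x, mul_inv_cancel_right₀ (hy'coe ▸ hy'0)]
  rw [hx]
  exact A.mul_mem _ _ (coe_absIntegers_mem_valuationSubring A w) hyinv

/-- The centre of a NON-trivial valuation ring of `K̄` is non-zero. [cite: NeukirchANT1999, Ch. II §8] -/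
theorem absIntegersCentre_ne_bot [NumberField K] (hA : A ≠ ⊤) : absIntegersCentre A ≠ ⊥ :=
  fun h => hA (eq_top_of_absIntegersCentre_eq_bot A h)

/-- **The centre of a non-trivial valuation ring of `K̄` is a MAXIMAL ideal of `ℤ̄`**: it is a non-zero prime,
it lies over a non-zero prime of the Dedekind domain `𝓞 K` (integrality), which is maximal, and primes over
maximal ideals in the integral extension `ℤ̄ / 𝓞 K` are maximal. [cite: AtiyahMacdonald1969, Cor 5.8] -/
theorem absIntegersCentre_isMaximal [NumberField K] (hA : A ≠ ⊤) : (absIntegersCentre A).IsMaximal := by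
  haveI := absIntegersCentre_isPrime A
  refine Ideal.isMaximal_of_isIntegral_of_isMaximal_comap (R := 𝓞 K) _ ?_
  set 𝔭 := (absIntegersCentre A).comap (algebraMap (𝓞 K) (absIntegers (𝓞 K) K)) with h𝔭
  have hne : 𝔭 ≠ ⊥ := fun hbot => absIntegersCentre_ne_bot A hA (Ideal.eq_bot_of_comap_eq_bot hbot)
  exact (Ideal.comap_isPrime _ _).isMaximal hne

end Centre

/-! ### The valuation ring with a given centre is `ℤ̄_𝔓` -/

section Bridge

variable [NumberField K] (A : ValuationSubring (AlgebraicClosure K))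
  (𝔓 : Ideal (absIntegers (𝓞 K) K)) [h𝔓 : 𝔓.IsMaximal]

/-- **The centre of `ℤ̄_𝔓` is `𝔓`**: an algebraic integer `a` is a non-unit of `ℤ̄_𝔓` iff `a ∈ 𝔓`
(`inv_mem_absIntegersLocalization_iff`). [cite: NeukirchANT1999, Ch. II §8] -/
theorem absIntegersCentre_absIntegersValuationSubring :
    absIntegersCentre (absIntegersValuationSubring 𝔓) = 𝔓 := by
  ext a
  rw [mem_absIntegersCentre_iff']
  by_cases ha0 : (a : AlgebraicClosure K) = 0
  · have : a = 0 := Subtype.ext ha0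
    simp [this]
  · rw [or_iff_right ha0, mem_absIntegersValuationSubring_iff,
      ← absIntegersResidue_eq_zero_iff 𝔓 ⟨a, coe_mem_absIntegersLocalization 𝔓 a⟩ ha0,
      absIntegersResidue_coe, Ideal.Quotient.eq_zero_iff_mem]

/-- `ℤ̄_𝔓 ≠ K̄` (its centre `𝔓` is non-zero). [cite: NeukirchANT1999, Ch. II §8] -/
theorem absIntegersValuationSubring_ne_top : absIntegersValuationSubring 𝔓 ≠ ⊤ := fun h =>
  ne_bot_of_isMaximal_absIntegers 𝔓
    ((absIntegersCentre_absIntegersValuationSubring 𝔓).symm.trans (h ▸ absIntegersCentre_top))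

/-- `ℤ̄_𝔓 ⊆ A` as soon as the centre of `A` is contained in `𝔓` (denominators `d ∉ 𝔓` are units of `A`).
[cite: NeukirchANT1999, Ch. II §8] -/
theorem absIntegersValuationSubring_le_of_absIntegersCentre_le (h : absIntegersCentre A ≤ 𝔓) :
    absIntegersValuationSubring 𝔓 ≤ A := by
  intro x hx
  obtain ⟨n, d, hd, hnd⟩ := (mem_absIntegersValuationSubring_iff 𝔓).1 hx
  obtain ⟨hd0, hdinv⟩ := (not_mem_absIntegersCentre_iff A d).1 fun hd' => hd (h hd')
  have hx' : x = (n : AlgebraicClosure K) * (d : AlgebraicClosure K)⁻¹ := by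
    rw [← hnd, mul_inv_cancel_right₀ hd0]
  rw [hx']
  exact A.mul_mem _ _ (coe_absIntegers_mem_valuationSubring A n) hdinv

/-- `A ⊆ ℤ̄_𝔓` as soon as `𝔓` EQUALS the centre of `A` (both inclusions are used): for `x ∈ A ∖ ℤ̄_𝔓`,
`x⁻¹ = n / d ∈ ℤ̄_𝔓` with `n ∈ 𝔓 ⊆ 𝔪_A` and `d ∉ 𝔓`, so `d` is a unit of `A`; but `d = x · n` gives
`1 = (d⁻¹ x) · n ∈ 𝔪_A`, absurd. [cite: NeukirchANT1999, Ch. II §8] -/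
theorem le_absIntegersValuationSubring_of_le_absIntegersCentre (h : 𝔓 ≤ absIntegersCentre A)
    (h' : absIntegersCentre A ≤ 𝔓) : A ≤ absIntegersValuationSubring 𝔓 := by
  intro x hxA
  by_contra hx
  have hx0 : x ≠ 0 := fun h0 => hx (h0 ▸ (absIntegersValuationSubring 𝔓).zero_mem)
  -- `x⁻¹ ∈ ℤ̄_𝔓`, `x⁻¹ = n / d`, and `n ∈ 𝔓` (else `x = d / n ∈ ℤ̄_𝔓`)
  have hxinv : x⁻¹ ∈ absIntegersValuationSubring 𝔓 :=
    ((absIntegersValuationSubring 𝔓).mem_or_inv_mem x).resolve_left hx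
  obtain ⟨n, d, hd, hnd⟩ := (mem_absIntegersValuationSubring_iff 𝔓).1 hxinv
  have hd0 : (d : AlgebraicClosure K) ≠ 0 := coe_ne_zero_of_notMem 𝔓 hd
  have hn : n ∈ 𝔓 := by
    by_contra hn
    apply hx
    rw [mem_absIntegersValuationSubring_iff, mem_absIntegersLocalization_iff]
    refine ⟨d, n, hn, ?_⟩
    have hn0 : (n : AlgebraicClosure K) ≠ 0 := coe_ne_zero_of_notMem 𝔓 hn
    -- from `x⁻¹ * d = n`: `x * n = d`
    have := congrArg (fun z => x * z) hnd
    simp only [← mul_assoc, mul_inv_cancel₀ hx0, one_mul] at this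
    exact this.symm
  -- `n ∈ 𝔪_A`, `d ∈ Aˣ`, but `d = x · n` with `x ∈ A`
  have hnA : (n : AlgebraicClosure K) ∈ A.nonunits := (mem_absIntegersCentre_iff A n).1 (h hn)
  obtain ⟨-, hdinv⟩ := (not_mem_absIntegersCentre_iff A d).1 fun hd' => hd (h' hd')
  have hdn : (d : AlgebraicClosure K) = x * n := by
    have := congrArg (fun z => x * z) hnd
    simp only [← mul_assoc, mul_inv_cancel₀ hx0, one_mul] at this
    exact this
  -- `1 = (d⁻¹ · x) · n` has valuation `< 1`: contradiction
  have hlt : A.valuation ((((d : AlgebraicClosure K)⁻¹ * x) * n)) < 1 := by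
    rw [map_mul]
    exact (mul_le_of_le_one_left' ((A.valuation_le_one_iff _).2 (A.mul_mem _ _ hdinv hxA))).trans_lt
      ((A.mem_nonunits_iff).1 hnA)
  have h1 : ((d : AlgebraicClosure K)⁻¹ * x) * n = 1 := by
    rw [mul_assoc, ← hdn, inv_mul_cancel₀ hd0]
  rw [h1, map_one] at hlt
  exact lt_irrefl _ hlt

/-- **A valuation ring of `K̄` with centre `𝔓` is `ℤ̄_𝔓`.** [cite: NeukirchANT1999, Ch. II §8] -/
theorem eq_absIntegersValuationSubring_of_absIntegersCentre_eq (h : absIntegersCentre A = 𝔓) :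
    A = absIntegersValuationSubring 𝔓 :=
  le_antisymm (le_absIntegersValuationSubring_of_le_absIntegersCentre A 𝔓 h.ge h.le)
    (absIntegersValuationSubring_le_of_absIntegersCentre_le A 𝔓 h.le)

/-- `𝔓 ↦ ℤ̄_𝔓` is injective on maximal ideals. [cite: NeukirchANT1999, Ch. II §8] -/
theorem absIntegersValuationSubring_injective (𝔔 : Ideal (absIntegers (𝓞 K) K)) [𝔔.IsMaximal]
    (h : absIntegersValuationSubring 𝔓 = absIntegersValuationSubring 𝔔) : 𝔓 = 𝔔 := by
  rw [← absIntegersCentre_absIntegersValuationSubring 𝔓, h, absIntegersCentre_absIntegersValuationSubring]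

end Bridge

/-! ### The bijection `MaximalSpectrum ℤ̄ ≃ {A // A ≠ ⊤}` -/

section Equiv

variable (K)
variable [NumberField K]

/-- **Finite places of `K̄` = maximal ideals of `ℤ̄`**: `𝔓 ↦ ℤ̄_𝔓` is a bijection from the maximal spectrum of
the algebraic integers onto the non-trivial valuation rings of `K̄`, with inverse the centre.
[cite: NeukirchANT1999, Ch. II §8] -/
def maximalSpectrumEquivValuationSubring :
    MaximalSpectrum (absIntegers (𝓞 K) K) ≃ {A : ValuationSubring (AlgebraicClosure K) // A ≠ ⊤} where
  toFun 𝔓 := ⟨absIntegersValuationSubring 𝔓.asIdeal, absIntegersValuationSubring_ne_top 𝔓.asIdeal⟩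
  invFun A := ⟨absIntegersCentre A.1, absIntegersCentre_isMaximal A.1 A.2⟩
  left_inv 𝔓 := by
    obtain ⟨I, hI⟩ := 𝔓
    dsimp only
    congr 1
    exact absIntegersCentre_absIntegersValuationSubring I
  right_inv A := by
    haveI := absIntegersCentre_isMaximal A.1 A.2
    exact Subtype.ext (eq_absIntegersValuationSubring_of_absIntegersCentre_eq A.1 (absIntegersCentre A.1) rfl).symm

variable {K}

/-- The bijection on underlying valuation rings. [cite: NeukirchANT1999, Ch. II §8] -/
@[simp] theorem coe_maximalSpectrumEquivValuationSubring (𝔓 : MaximalSpectrum (absIntegers (𝓞 K) K)) :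
    ((maximalSpectrumEquivValuationSubring K 𝔓 : {A : ValuationSubring (AlgebraicClosure K) // A ≠ ⊤}) :
      ValuationSubring (AlgebraicClosure K)) = absIntegersValuationSubring 𝔓.asIdeal := rfl

/-- The inverse bijection is the centre. [cite: NeukirchANT1999, Ch. II §8] -/
@[simp] theorem maximalSpectrumEquivValuationSubring_symm_asIdeal
    (A : {A : ValuationSubring (AlgebraicClosure K) // A ≠ ⊤}) :
    ((maximalSpectrumEquivValuationSubring K).symm A).asIdeal = absIntegersCentre A.1 := rfl

end Equiv

/-! ### `G_K`-equivariance: decomposition groups agree -/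

section Equivariance

variable (A : ValuationSubring (AlgebraicClosure K)) (σ : absoluteGaloisGroup K)

/-- **The centre is `G_K`-equivariant**: `centre (σ • A) = σ • centre A` (pointwise actions of
`G_K = Gal(K̄/K)` on valuation rings of `K̄` and on ideals of `ℤ̄`). [cite: NeukirchANT1999, Ch. II §9 (9.1)] -/
theorem absIntegersCentre_smul : absIntegersCentre (σ • A) = σ • absIntegersCentre A := by
  ext a
  rw [Ideal.mem_pointwise_smul_iff_inv_smul_mem, mem_absIntegersCentre_iff', mem_absIntegersCentre_iff',
    integralClosure.coe_smul, smul_eq_zero_iff_eq, ← smul_inv'',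
    ← ValuationSubring.mem_pointwise_smul_iff_inv_smul_mem]

variable [NumberField K]

/-- **`Stab_{G_K}(A) = Stab_{G_K}(𝔪_A ∩ ℤ̄)`** for a non-trivial valuation ring `A` of `K̄`: the decomposition
group of a finite place of `K̄` as the stabiliser of its valuation ring IS its decomposition group as the
stabiliser of the corresponding maximal ideal of `ℤ̄`. [cite: NeukirchANT1999, Ch. II §9 (9.1)] -/
theorem stabilizer_eq_stabilizer_absIntegersCentre (hA : A ≠ ⊤) :
    MulAction.stabilizer (absoluteGaloisGroup K) A =
      MulAction.stabilizer (absoluteGaloisGroup K) (absIntegersCentre A) := by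
  ext τ
  rw [MulAction.mem_stabilizer_iff, MulAction.mem_stabilizer_iff]
  constructor
  · intro h
    rw [← absIntegersCentre_smul, h]
  · intro h
    haveI := absIntegersCentre_isMaximal A hA
    rw [eq_absIntegersValuationSubring_of_absIntegersCentre_eq (τ • A) (absIntegersCentre A)
        ((absIntegersCentre_smul A τ).trans h),
      ← eq_absIntegersValuationSubring_of_absIntegersCentre_eq A (absIntegersCentre A) rfl]

variable (𝔓 : Ideal (absIntegers (𝓞 K) K)) [h𝔓 : 𝔓.IsMaximal]

/-- `σ • 𝔓` is again maximal (it is the centre of the non-trivial valuation ring `σ • ℤ̄_𝔓`).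
[cite: NeukirchANT1999, Ch. II §9 (9.1)] -/
theorem isMaximal_smul_absIntegers : (σ • 𝔓).IsMaximal := by
  have hne : σ • absIntegersValuationSubring 𝔓 ≠ ⊤ := fun h =>
    absIntegersValuationSubring_ne_top 𝔓 (by
      have := congrArg (fun B : ValuationSubring (AlgebraicClosure K) => σ⁻¹ • B) h
      simpa only [inv_smul_smul, ValuationSubring.pointwise_smul_toSubring] using
        this.trans (le_antisymm (ValuationSubring.le_top _) fun x _ =>
          ValuationSubring.mem_pointwise_smul_iff_inv_smul_mem.2 (ValuationSubring.mem_top _)))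
  rw [← absIntegersCentre_absIntegersValuationSubring 𝔓, ← absIntegersCentre_smul]
  exact absIntegersCentre_isMaximal _ hne

/-- **`σ • ℤ̄_𝔓 = ℤ̄_{σ • 𝔓}`**: the bijection «maximal ideals ↔ valuation rings» is `G_K`-equivariant.
[cite: NeukirchANT1999, Ch. II §9 (9.1)] -/
theorem smul_absIntegersValuationSubring :
    σ • absIntegersValuationSubring 𝔓 =
      @absIntegersValuationSubring K _ _ (σ • 𝔓) (isMaximal_smul_absIntegers σ 𝔓) := by
  haveI := isMaximal_smul_absIntegers σ 𝔓
  exact eq_absIntegersValuationSubring_of_absIntegersCentre_eq _ _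
    ((absIntegersCentre_smul _ σ).trans (by rw [absIntegersCentre_absIntegersValuationSubring]))

/-- **`Stab_{G_K}(ℤ̄_𝔓) = Stab_{G_K}(𝔓)`**: the decomposition group of the valuation ring `ℤ̄_𝔓`
(`ValuationSubring` side, as in `NumberFieldValuationProSet`) equals the decomposition group of the maximal ideal
`𝔓` of `ℤ̄` (`Ideal` side, as in the Frobenius / `DecompositionGroup*` files).
[cite: NeukirchANT1999, Ch. II §9 (9.1)] -/
theorem stabilizer_absIntegersValuationSubring :
    MulAction.stabilizer (absoluteGaloisGroup K) (absIntegersValuationSubring 𝔓) =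
      MulAction.stabilizer (absoluteGaloisGroup K) 𝔓 := by
  rw [stabilizer_eq_stabilizer_absIntegersCentre _ (absIntegersValuationSubring_ne_top 𝔓),
    absIntegersCentre_absIntegersValuationSubring]

end Equivariance

end Literature.NumberTheory.GaloisRepresentations

end
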